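import Summits.QuantumFields.BalabanUV.T4Continuum.Spine.NE4.LimitFormFromNE4
import Summits.QuantumFields.BalabanUV.T4Continuum.Spine.NE4.FadingFromRateRelAnalyticU2
import Summits.QuantumFields.BalabanUV.T4Continuum.Spine.NE4.FadingFromRateRelAnalyticUnique

/-!
# Spine/NE4/MinimalInterface — node U2 of the T⁴ spine in ONE statement: from {REAL NE4 for the data, relative real-analytic charts of its
# β-sections, the PRINTED upper bound} everything node U2 owes (U6's input, tuned uniqueness, the ∃ ⇒ ∀ passage), and with {(AF-1), (C), one
# sign} also binder B3 (the tuned runs EXIST) — one citable name for the dagwriter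

Cell `pub-balaban-gaps` (YM blitz G2), seat `ne4`, generation 7 (unit `pub-balaban-gaps-ne4-g7`); record `HOME/ne/NE4.md` §5 (R38)–(R40) and
`HOME/pub-balaban-gaps-ne4/U2-MINIMAL-INTERFACE.md` v4.  A PACKAGING file: no new estimate, no new shape; it conjoins by name
`LimitFormFromNE4.endpointExistence_of_ne4OnData_limPos` (R38), `FadingFromRateRelAnalyticU2.u2Output_under_of_localAnalyticRel` (R40) and
`FadingFromRateRelAnalyticUnique.tunedUniqueBelow_of_localAnalyticRel` ∕ `underHypotheses_of_E_localAnalyticRel` (R40), so that the dagwriter has ONE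
name per consumer and ONE for the whole node.

THE INPUT LIST (all BINDERS; the minimal print-faithful form reached by generation 7):
* β-side: `NE4OnData D c θ γᵤ` (NE4 for the FULL β, REAL, as the spine types it — NOT IN PRINT, GAPS G-t4-U2-1) and `LocalAnalyticRel B γᵤ ρ D.βfun`
  (real-analytic charts of RELATIVE radius `ρ·g` of the REAL one-coupling sections — the small-field domain SHAPE of [Balaban1988RG2Cluster] (1.34) as
  read by node U3's `T4CouplingAnalyticity.CouplingAnalyticRel`; printed TYPE for the last coupling only, [Balaban1987RG1] p. 264; uniformity in
  `(k, i)` UNPRINTED, G-adv2-3 ∕ G-t4-U2-2);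
* flow-side: the PRINTED-type upper bound `BetaUpperH β′ γᵤ D.βfun` with `γᵤ²β′ < 1` (to run (0.20) forward);
* for B3 in addition: the corner bound (AF-1) `|β¹_{k+1}(p)| ≤ Cr·p_k` (row an4), joint continuity (C) (row an4), and ONE BIT `0 < lim β⁰` (row an3∕an5).
NOT in the list: `EventualLowerH` (no asymptotic-freedom lower bound), a second radius, a window binder, a complex history family, analyticity at
`g = 0`, `HistLipschitz`∕`FadingMemory` as hypotheses, (AF-0r) (inside NE4), a floor constant, row NE9.

HONEST FRAMING: packaging of kernel bookkeeping over hypothesis shapes; nothing of Bałaban's asserted beyond print; NE4 NOT IN PRINT, NOT PROVED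
(DEPENDENT = (R)∘{NE5} + (AF-0r)); B3 NOT discharged (0∕6); [Balaban1987RG1] Thm 2 NOT proved; spine 0∕9; one finite T⁴ — NOT continuum on ℝ⁴, NOT
infinite volume, NOT a mass gap, NOT Clay.  0 sorry, 0 def; axioms standard.
Reference (TYPES only): [Balaban1987RG1] = T. Bałaban, CMP **109** (1987) 249–301, (0.20) p. 256, Thm 2 p. 259, §1 p. 264.
-/

noncomputable section

namespace Summit.QuantumFields.BalabanUV.T4Continuum.Spine.NE4

open Set Filter Topology
open Literature.MathematicalPhysics.QuantumFieldTheory.Balaban1983to89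
open Literature.MathematicalPhysics.QuantumFieldTheory.Balaban1983to89.FlowStep
open Literature.MathematicalPhysics.QuantumFieldTheory.Balaban1983to89.T4CouplingMatching
open Literature.MathematicalPhysics.QuantumFieldTheory.Balaban1983to89.T4Continuum
open Literature.MathematicalPhysics.QuantumFieldTheory.Balaban1983to89.T4TwoRunUniqueness (TunedUniqueBelow)

universe u

variable {F : T4Family} {G : Type u} [GaugeGroup G] [MeasurableSpace G] [HaarData G]

/-- **NODE U2, MINIMAL INTERFACE — what the node OWES, from the print-faithful input list.**  For Bałaban's data `D`: NE4 for the data (real),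
relative real-analytic charts of its β-sections, the printed-type upper bound with `γᵤ²β′ < 1`, rates `θ < θ′ < ρ′ < 1` ⟹
(i) node U6's input under the targets' prefix, `D.UnderHypotheses Hβ (fun g₀ ↦ U2Output D g₀ (2c∕(1−ρ′)) ρ′)` (geometric, K-uniform matching of
consecutive tuned runs; run box CHOSEN, one radius, no AF lower bound); (ii) [Balaban1987RG1] Thm 2's tuned bare coupling UNIQUE below an explicit
γᵤ-free threshold, `TunedUniqueBelow D (min γᵤ γ⋆)`; (iii) hence the ∃-reading of every target implies its ∀-reading.  Conjunction of
`u2Output_under_of_localAnalyticRel`, `tunedUniqueBelow_of_localAnalyticRel`, `underHypotheses_of_E_localAnalyticRel`. [folklore] -/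
theorem nodeU2_minimal (D : FiniteEpsData F G) {Hβ : Prop} {cc : (ℕ → ℝ) → Prop} {c θ θ' ρ' γu ρ B β' : ℝ}
    (hN : NE4OnData D c θ γu) (hL : LocalAnalyticRel B γu ρ D.βfun) (hhi : BetaUpperH β' γu D.βfun) (hγβ : γu ^ 2 * β' < 1)
    (hc : 0 ≤ c) (hθ0 : 0 < θ) (hθ1 : θ < 1) (hB : 0 < B) (hρ : 0 < ρ) (hρ1 : ρ ≤ 1) (hγu : 0 < γu)
    (hθθ' : θ < θ') (hθ'ρ' : θ' < ρ') (hρ'1 : ρ' < 1) :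
    (D.UnderHypotheses Hβ fun g₀ => U2Output D g₀ (2 * c / (1 - ρ')) ρ') ∧
      TunedUniqueBelow D (min γu (min 1 ((1 - θ') ^ 2 / (4 * (relAnalyticFading c θ B ρ θ' + 1))))) ∧
      (D.UnderHypothesesE Hβ cc → D.UnderHypotheses Hβ cc) :=
  ⟨u2Output_under_of_localAnalyticRel D hL hN hc hθ0 hθ1 hB hρ hρ1 hγu hθθ' hθ'ρ' hρ'1 hhi hγβ,
    tunedUniqueBelow_of_localAnalyticRel D hL hN hc hθ0 hθ1 hB hρ hρ1 hγu hθθ' (hθ'ρ'.trans hρ'1) hhi hγβ,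
    underHypotheses_of_E_localAnalyticRel D hL hN hc hθ0 hθ1 hB hρ hρ1 hγu hθθ' (hθ'ρ'.trans hρ'1) hhi hγβ⟩

/-- **NODE U2 + BINDER B3 — the whole β-side of the apex's flow bookkeeping from NE4.**  Adding to `nodeU2_minimal`'s inputs the printed one-loop
split `S` of `D.βfun`, the corner bound (AF-1), joint continuity (C) and the ONE BIT `0 < lim β⁰` gives ALSO `DagBinding.EndpointExistence D.C.toB12`
(binder B3: for every small renormalised `g` and every `K` a bare coupling — the tuned sequences EXIST, `T4Continuum.FiniteEpsData.exists_tuned`), by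
`endpointExistence_of_ne4OnData_limPos` (the β sub-cell's `LimitForm` constructed from NE4).  Every input is a BINDER; nothing printed is
asserted; B3 is NOT thereby discharged. [cite: Balaban1987RG1, Thm 2 p.259 and (0.20) p.256] -/
theorem nodeU2_and_B3_of_ne4 (D : FiniteEpsData F G) (S : B12Beta.OneLoopSplit D.βfun) {Hβ : Prop} {cc : (ℕ → ℝ) → Prop}
    {c θ θ' ρ' γu ρ B β' Cr : ℝ}
    (hN : NE4OnData D c θ γu) (hL : LocalAnalyticRel B γu ρ D.βfun) (hhi : BetaUpperH β' γu D.βfun) (hγβ : γu ^ 2 * β' < 1)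
    (hAF1 : ∀ k (p : Fin (k + 1) → ℝ), p ∈ Box γu k → |S.β1 k p| ≤ Cr * p (Fin.last k)) (hCr : 0 ≤ Cr)
    (hcont : BetaContH γu D.βfun) (hpos : 0 < limUnder atTop S.β0)
    (hc : 0 ≤ c) (hθ0 : 0 < θ) (hθ1 : θ < 1) (hB : 0 < B) (hρ : 0 < ρ) (hρ1 : ρ ≤ 1) (hγu : 0 < γu)
    (hθθ' : θ < θ') (hθ'ρ' : θ' < ρ') (hρ'1 : ρ' < 1) :
    DagBinding.EndpointExistence D.C.toB12 ∧
      (D.UnderHypotheses Hβ fun g₀ => U2Output D g₀ (2 * c / (1 - ρ')) ρ') ∧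
      TunedUniqueBelow D (min γu (min 1 ((1 - θ') ^ 2 / (4 * (relAnalyticFading c θ B ρ θ' + 1))))) ∧
      (D.UnderHypothesesE Hβ cc → D.UnderHypotheses Hβ cc) :=
  ⟨endpointExistence_of_ne4OnData_limPos D S hγu hθ0.le hθ1 hN hAF1 hCr hpos hcont hhi,
    nodeU2_minimal D hN hL hhi hγβ hc hθ0 hθ1 hB hρ hρ1 hγu hθθ' hθ'ρ' hρ'1⟩

/-- **NON-VACUITY OF THE PREFIX UNDER THESE BINDERS**: with B3 from `nodeU2_and_B3_of_ne4`'s inputs, tuned sequences EXIST for all small `γ`, `g`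
(`FiniteEpsData.exists_tuned`), so conclusion (i) of `nodeU2_minimal` is not true by emptiness. [folklore] -/
theorem exists_tuned_of_ne4 (D : FiniteEpsData F G) (S : B12Beta.OneLoopSplit D.βfun) {c θ γu β' Cr : ℝ}
    (hN : NE4OnData D c θ γu) (hhi : BetaUpperH β' γu D.βfun)
    (hAF1 : ∀ k (p : Fin (k + 1) → ℝ), p ∈ Box γu k → |S.β1 k p| ≤ Cr * p (Fin.last k)) (hCr : 0 ≤ Cr)
    (hcont : BetaContH γu D.βfun) (hpos : 0 < limUnder atTop S.β0) (hθ0 : 0 ≤ θ) (hθ1 : θ < 1) (hγu : 0 < γu) :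
    ∃ γ₀ : ℝ, 0 < γ₀ ∧ ∀ γ : ℝ, 0 < γ → γ ≤ γ₀ → ∃ g₁ : ℝ, 0 < g₁ ∧ ∀ g : ℝ, 0 < g → g ≤ g₁ →
      ∃ g₀ : ℕ → ℝ, D.Tuned γ g g₀ :=
  D.exists_tuned (endpointExistence_of_ne4OnData_limPos D S hγu hθ0 hθ1 hN hAF1 hCr hpos hcont hhi)

end Summit.QuantumFields.BalabanUV.T4Continuum.Spine.NE4

end
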